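import Summits.ResolutionOfSingularities.ResolutionOfSingularities.Theorems.PurelyInseparableDim4JointHereditaryHostStep
import Summits.ResolutionOfSingularities.ResolutionOfSingularities.Theorems.PurelyInseparableDim4JointHereditarySurvival
import Summits.ResolutionOfSingularities.ResolutionOfSingularities.Theorems.PurelyInseparableDim4JointWaitingNodeStepMembers
import HarnessLib

/-!
# Purely inseparable four-folds: the node step with HEREDITARY waiting, MEMBERS SIDE (brick S3 (c) «joint point∘coordinate chains»,
# part 64 = v3-H, node step; cell `res-dim4-pi`)

[OURS · counted 0] (D-0157 DOOR 2; host item stmt-ResolutionOfSingularities-16155, helper). Nothing here proves resolution of singularities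
in dimension ≥ 4 / characteristic `p`. Part 53 (`joint_waiting_node_step`) in the v3-H format of part 60: at a node whose coordinate members
carry `MemberDataH` (own waiting entries `wplan (cst c) (ctr c)` with regions `wreg c`), blowing up `c₁` gives the next members
`cms′ = children (WITH hereditary entries and regions) ∪ waiting kids ∪ survivors` with `MemberDataH` (parts 62, 63), the three
disjointness invariants (member/member, member/foreign region, region/region), the MULTISET IDENTITY on the members' pairs
`Σ_{cms′} {pair} + {(s₁, S₁)} = Σ_{cms} {pair} + children pairs + waiting-kid pairs` (every new pair lies `HEdge`-below `(s₁, S₁)`: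
`CutExpand`), positions of members and regions, the covers (four-way over the host modulo leaves; off the host over a waiting region;
survivors; survivor regions) and the finiteness of the leaf points.

* **`joint_hereditary_node_step`**. AI-produced formalisation, weaker than expert review.
bears_on: LADDER-RESOLUTION:D157-DOOR2 (res-dim4-pi · S3 (c) joint v3-H · node step).
-/

set_option linter.dupNamespace false -- D-0017: single-problem summit path `Summit.<S>.<S>.…` by design

noncomputable section

open MvPolynomial Finset CategoryTheory AlgebraicGeometry Opposite TopologicalSpace
open AlgebraicGeometry.Scheme.IdealSheafData (ofIdealTop vanishingIdeal)

namespace Summit.ResolutionOfSingularities.ResolutionOfSingularities.Theorems.PIDim4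

open Literature.AlgebraicGeometry.Resolution
open Literature.AlgebraicGeometry.Resolution.Hauser2010
open Literature.AlgebraicGeometry.Resolution.AffinePointBlowup (P A γ coord Wtop ξ)

namespace Equimultiple

section NodeStepH

variable {K : Type} [Field K] {p : ℕ} [hp : Fact p.Prime] [CharP K p] [DecidableEq K]
variable {X' : Scheme.{0}}

/-- **THE NODE STEP WITH HEREDITARY WAITING, MEMBERS SIDE.** See the module docstring.
[cite: BierstoneGrigorievMilmanWlodarczyk2011, Def. 3.1.3; §4 Step 2b] [cite: Hauser2010, §§F–G] [cite: StacksProject, Tag 02OS] -/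
theorem joint_hereditary_node_step [IsAlgClosed K] [IsLocallyNoetherian X'] (M' : MarkedIdeal X') (hmult : M'.mult = p)
    (plan : State K → Finset (Fin 4) → Finset (Fin 4 × (Fin 4 → K) × Finset (Fin 4)))
    (leaves : State K → Finset (Fin 4) → Finset (Fin 4 × (Fin 4 → K)))
    (wplan : State K → Finset (Fin 4) → Finset (Fin 4 × (Fin 4 → K) × Finset (Fin 4)))
    (cms : Finset (Closeds X')) (cst : Closeds X' → State K) (ctr : Closeds X' → Finset (Fin 4))
    (wreg : Closeds X' → Fin 4 × (Fin 4 → K) × Finset (Fin 4) → Closeds X')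
    (hcdata : ∀ c ∈ cms, MemberDataH p plan leaves wplan M' c (cst c) (ctr c) (wreg c))
    (hdisj₁ : ∀ c ∈ cms, ∀ c' ∈ cms, c ≠ c' → Disjoint (c : Set X') (c' : Set X'))
    (hdisjW : ∀ c ∈ cms, ∀ c' ∈ cms, c ≠ c' → ∀ wt ∈ wplan (cst c') (ctr c'), Disjoint (c : Set X') (wreg c' wt : Set X'))
    (hdisjWW : ∀ c ∈ cms, ∀ c' ∈ cms, c ≠ c' → ∀ wt ∈ wplan (cst c) (ctr c), ∀ wt' ∈ wplan (cst c') (ctr c'),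
      Disjoint (wreg c wt : Set X') (wreg c' wt' : Set X'))
    {c₁ : Closeds X'} (hc₁ : c₁ ∈ cms) :
    ∃ (cms' : Finset (Closeds (blowup (vanishingIdeal c₁)))) (cst' : Closeds (blowup (vanishingIdeal c₁)) → State K)
      (ctr' : Closeds (blowup (vanishingIdeal c₁)) → Finset (Fin 4))
      (wreg' : Closeds (blowup (vanishingIdeal c₁)) → Fin 4 × (Fin 4 → K) × Finset (Fin 4) →
        Closeds (blowup (vanishingIdeal c₁))),
      (∀ d ∈ cms', MemberDataH p plan leaves wplan (M'.transform (blowup.π (vanishingIdeal c₁)) (vanishingIdeal c₁)) d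
        (cst' d) (ctr' d) (wreg' d)) ∧
      (∀ d ∈ cms', ∀ d' ∈ cms', d ≠ d' →
        Disjoint (d : Set (blowup (vanishingIdeal c₁))) (d' : Set (blowup (vanishingIdeal c₁)))) ∧
      (∀ d ∈ cms', ∀ d' ∈ cms', d ≠ d' → ∀ wt ∈ wplan (cst' d') (ctr' d'),
        Disjoint (d : Set (blowup (vanishingIdeal c₁))) (wreg' d' wt : Set (blowup (vanishingIdeal c₁)))) ∧
      (∀ d ∈ cms', ∀ d' ∈ cms', d ≠ d' → ∀ wt ∈ wplan (cst' d) (ctr' d), ∀ wt' ∈ wplan (cst' d') (ctr' d'),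
        Disjoint (wreg' d wt : Set (blowup (vanishingIdeal c₁))) (wreg' d' wt' : Set (blowup (vanishingIdeal c₁)))) ∧
      (∑ d ∈ cms', ({(cst' d, ctr' d)} : Multiset (State K × Finset (Fin 4))) + {(cst c₁, ctr c₁)} =
        ∑ c ∈ cms, ({(cst c, ctr c)} : Multiset (State K × Finset (Fin 4))) +
          ((plan (cst c₁) (ctr c₁)).val.map fun e => (CentreBlowup.step p (ctr c₁) e.1 e.2.1 (cst c₁), e.2.2)) +
          ((wplan (cst c₁) (ctr c₁)).val.map fun wt => (CentreBlowup.step p (ctr c₁) wt.1 wt.2.1 (cst c₁), wt.2.2))) ∧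
      (∀ d ∈ cms', (∃ t, (t ∈ plan (cst c₁) (ctr c₁) ∨ t ∈ wplan (cst c₁) (ctr c₁)) ∧
          (cst' d, ctr' d) = (CentreBlowup.step p (ctr c₁) t.1 t.2.1 (cst c₁), t.2.2)) ∨
        ∃ c ∈ cms, c ≠ c₁ ∧ (cst' d, ctr' d) = (cst c, ctr c)) ∧
      (∀ d ∈ cms', ∀ w ∈ (d : Set (blowup (vanishingIdeal c₁))),
        blowup.π (vanishingIdeal c₁) w ∈ (c₁ : Set X') ∨
          (∃ wt ∈ wplan (cst c₁) (ctr c₁), blowup.π (vanishingIdeal c₁) w ∈ (wreg c₁ wt : Set X')) ∨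
          ∃ c ∈ cms, c ≠ c₁ ∧ blowup.π (vanishingIdeal c₁) w ∈ (c : Set X')) ∧
      (∀ d ∈ cms', ∀ wt ∈ wplan (cst' d) (ctr' d), ∀ w ∈ (wreg' d wt : Set (blowup (vanishingIdeal c₁))),
        blowup.π (vanishingIdeal c₁) w ∈ (c₁ : Set X') ∨
          ∃ c ∈ cms, c ≠ c₁ ∧ ∃ wt₀ ∈ wplan (cst c) (ctr c), blowup.π (vanishingIdeal c₁) w ∈ (wreg c wt₀ : Set X')) ∧
      (∀ w : blowup (vanishingIdeal c₁), IsClosed ({w} : Set (blowup (vanishingIdeal c₁))) →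
        blowup.π (vanishingIdeal c₁) w ∈ (c₁ : Set X') →
        (p : ℕ∞) ≤ idealOrder (M'.transform (blowup.π (vanishingIdeal c₁)) (vanishingIdeal c₁)).ideal w →
        (∃ d ∈ cms', w ∈ (d : Set (blowup (vanishingIdeal c₁)))) ∨
        (∃ d ∈ cms', ∃ wt ∈ wplan (cst' d) (ctr' d), w ∈ (wreg' d wt : Set (blowup (vanishingIdeal c₁)))) ∨
        ∃ l ∈ leaves (cst c₁) (ctr c₁), l.1 ∈ ctr c₁ ∧ l.2 l.1 = 0 ∧
          CentreBlowup.IsEquimultiplePoint p (ctr c₁) l.1 l.2 (cst c₁) ∧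
          ∃ (Y' : Scheme.{0}) (φ' : Y' ⟶ blowup (vanishingIdeal c₁)) (ψ' : Y' ⟶ P 4 K) (_ : IsOpenImmersion φ')
            (_ : IsOpenImmersion ψ') (y' : Y'), φ' y' = w ∧ ψ' y' = ξ 4 K ∧
            (M'.transform (blowup.π (vanishingIdeal c₁)) (vanishingIdeal c₁)).ideal.comap φ' =
              (hypSheaf p (CentreBlowup.step p (ctr c₁) l.1 l.2 (cst c₁)).F).comap ψ') ∧
      (∀ w : blowup (vanishingIdeal c₁), IsClosed ({w} : Set (blowup (vanishingIdeal c₁))) →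
        (p : ℕ∞) ≤ idealOrder (M'.transform (blowup.π (vanishingIdeal c₁)) (vanishingIdeal c₁)).ideal w →
        blowup.π (vanishingIdeal c₁) w ∉ (c₁ : Set X') →
        ∀ wt ∈ wplan (cst c₁) (ctr c₁), blowup.π (vanishingIdeal c₁) w ∈ (wreg c₁ wt : Set X') →
        ∃ d ∈ cms', w ∈ (d : Set (blowup (vanishingIdeal c₁)))) ∧
      (∀ w : blowup (vanishingIdeal c₁), ∀ c ∈ cms, c ≠ c₁ →
        (blowup.π (vanishingIdeal c₁) w ∈ (c : Set X') → ∃ d ∈ cms', w ∈ (d : Set (blowup (vanishingIdeal c₁)))) ∧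
        ∀ wt ∈ wplan (cst c) (ctr c), blowup.π (vanishingIdeal c₁) w ∈ (wreg c wt : Set X') →
          ∃ d ∈ cms', ∃ wt' ∈ wplan (cst' d) (ctr' d), w ∈ (wreg' d wt' : Set (blowup (vanishingIdeal c₁)))) ∧
      {w : blowup (vanishingIdeal c₁) | IsClosed ({w} : Set (blowup (vanishingIdeal c₁))) ∧
        blowup.π (vanishingIdeal c₁) w ∈ (c₁ : Set X') ∧
        (p : ℕ∞) ≤ idealOrder (M'.transform (blowup.π (vanishingIdeal c₁)) (vanishingIdeal c₁)).ideal w ∧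
        (∀ d ∈ cms', w ∉ (d : Set (blowup (vanishingIdeal c₁)))) ∧
        ∀ d ∈ cms', ∀ wt ∈ wplan (cst' d) (ctr' d), w ∉ (wreg' d wt : Set (blowup (vanishingIdeal c₁)))}.Finite := by
  classical
  obtain ⟨kid, rgn, wkid, hkid, hwkid, hkdisj, hkw, hww, hrk, hrw, hrr, hkcover, hwcover, hkfin⟩ :=
    memberDataH_host_step M' hmult plan leaves wplan c₁ (hcdata c₁ hc₁)
  set s₁ := cst c₁ with hs₁
  set S₁ := ctr c₁ with hS₁def
  set Pl := plan s₁ S₁ with hPl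
  set Wt₁ := wplan s₁ S₁ with hWt₁
  have hπ : IsBlowup (blowup.π (vanishingIdeal c₁)) (vanishingIdeal c₁) := blowup.isBlowup _
  haveI : IsProper (blowup.π (vanishingIdeal c₁)) := hπ.isProper
  haveI : IsLocallyNoetherian (blowup (vanishingIdeal c₁)) := LocallyOfFiniteType.isLocallyNoetherian (blowup.π (vanishingIdeal c₁))
  have hCsupp : ((vanishingIdeal c₁).support : Set X') = (c₁ : Set X') := by
    rw [Scheme.IdealSheafData.coe_support_vanishingIdeal]
  have hsncC : HasSNCWith M'.boundary (vanishingIdeal c₁) := (hcdata c₁ hc₁).2.2.2.2.1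
  -- positions
  have hkid_over : ∀ e ∈ Pl, ∀ w ∈ (kid e : Set (blowup (vanishingIdeal c₁))), blowup.π (vanishingIdeal c₁) w ∈ (c₁ : Set X') :=
    fun e he w hw => (hkid e he).2.1 hw
  have hrgn_over : ∀ e ∈ Pl, ∀ wt ∈ wplan (CentreBlowup.step p S₁ e.1 e.2.1 s₁) e.2.2,
      ∀ w ∈ (rgn e wt : Set (blowup (vanishingIdeal c₁))), blowup.π (vanishingIdeal c₁) w ∈ (c₁ : Set X') :=
    fun e he wt hwt w hw => (hkid e he).2.2.2 wt hwt hw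
  have hwkid_over : ∀ wt ∈ Wt₁, ∀ w ∈ (wkid wt : Set (blowup (vanishingIdeal c₁))),
      blowup.π (vanishingIdeal c₁) w ∈ (wreg c₁ wt : Set X') := fun wt hwt w hw => (hwkid wt hwt).2.1 hw
  have hkid_inj : ∀ e ∈ Pl, ∀ e' ∈ Pl, kid e = kid e' → e = e' := fun e he e' he' hee => by
    by_contra hne
    obtain ⟨w, hw⟩ := (hkid e he).2.2.1
    exact Set.disjoint_left.mp (hkdisj e he e' he' hne) hw (by rw [← hee]; exact hw)
  have hwkid_inj : ∀ wt ∈ Wt₁, ∀ wt' ∈ Wt₁, wkid wt = wkid wt' → wt = wt' := fun wt hwt wt' hwt' hee => by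
    by_contra hne
    obtain ⟨w, hw⟩ := (hwkid wt hwt).2.2
    exact Set.disjoint_left.mp (hww wt hwt wt' hwt' hne) hw (by rw [← hee]; exact hw)
  have hkid_ne_wkid : ∀ e ∈ Pl, ∀ wt ∈ Wt₁, kid e ≠ wkid wt := fun e he wt hwt hee => by
    obtain ⟨w, hw⟩ := (hkid e he).2.2.1
    exact Set.disjoint_left.mp (hkw e he wt hwt) hw (by rw [← hee]; exact hw)
  -- survivors
  set prei : Closeds X' → Closeds (blowup (vanishingIdeal c₁)) := fun c => c.preimage (blowup.π (vanishingIdeal c₁)).continuous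
    with hprei
  have hne₁ : ∀ c ∈ cms.erase c₁, c ≠ c₁ := fun c hc => Finset.ne_of_mem_erase hc
  have hmem₁ : ∀ c ∈ cms.erase c₁, c ∈ cms := fun c hc => Finset.mem_of_mem_erase hc
  have hdisjC : ∀ c ∈ cms.erase c₁, Disjoint (c : Set X') ((vanishingIdeal c₁).support : Set X') := fun c hc => by
    rw [hCsupp]; exact hdisj₁ c (hmem₁ c hc) c₁ hc₁ (hne₁ c hc)
  have hprei_inj : Set.InjOn prei ↑(cms.erase c₁) := fun c hc c' hc' hcc => by
    have key : ∀ {d d' : Closeds X'}, d ∈ cms.erase c₁ → prei d = prei d' → (d : Set X') ⊆ (d' : Set X') := by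
      intro d d' hd hdd x hx
      obtain ⟨w, hw⟩ := exists_eq_of_not_mem_support hπ (Set.disjoint_left.mp (hdisjC d hd) hx)
      have hw' : w ∈ (prei d : Set (blowup (vanishingIdeal c₁))) := by
        change blowup.π (vanishingIdeal c₁) w ∈ (d : Set X'); rw [hw]; exact hx
      rw [hdd] at hw'
      change blowup.π (vanishingIdeal c₁) w ∈ (d' : Set X') at hw'
      rwa [hw] at hw'
    exact Closeds.ext (Set.Subset.antisymm (key hc hcc) (key hc' hcc.symm))
  have hkid_ne_prei : ∀ e ∈ Pl, ∀ c ∈ cms.erase c₁, kid e ≠ prei c := fun e he c hc hec => by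
    obtain ⟨w, hw⟩ := (hkid e he).2.2.1
    have h1 := hkid_over e he w hw
    rw [hec] at hw
    exact Set.disjoint_left.mp (hdisj₁ c (hmem₁ c hc) c₁ hc₁ (hne₁ c hc)) hw h1
  have hwkid_ne_prei : ∀ wt ∈ Wt₁, ∀ c ∈ cms.erase c₁, wkid wt ≠ prei c := fun wt hwt c hc hec => by
    obtain ⟨w, hw⟩ := (hwkid wt hwt).2.2
    have h1 := hwkid_over wt hwt w hw
    rw [hec] at hw
    exact Set.disjoint_left.mp (hdisjW c (hmem₁ c hc) c₁ hc₁ (hne₁ c hc) wt hwt) hw h1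
  -- the new members
  set kidsF : Finset (Closeds (blowup (vanishingIdeal c₁))) := Pl.image kid with hkidsF
  set wkidsF : Finset (Closeds (blowup (vanishingIdeal c₁))) := Wt₁.image wkid with hwkidsF
  set survF : Finset (Closeds (blowup (vanishingIdeal c₁))) := (cms.erase c₁).image prei with hsurvF
  have hdisj_kw : Disjoint kidsF wkidsF := Finset.disjoint_left.mpr fun ⦃d⦄ hd hd' => by
    obtain ⟨e, he, rfl⟩ := Finset.mem_image.mp hd
    obtain ⟨wt, hwt, hce⟩ := Finset.mem_image.mp hd'
    exact hkid_ne_wkid e he wt hwt hce.symm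
  have hdisj_ks : Disjoint (kidsF.disjUnion wkidsF hdisj_kw) survF := Finset.disjoint_left.mpr fun ⦃d⦄ hd hd' => by
    obtain ⟨c, hc, hce⟩ := Finset.mem_image.mp hd'
    rcases Finset.mem_disjUnion.mp hd with hd | hd
    · obtain ⟨e, he, rfl⟩ := Finset.mem_image.mp hd
      exact hkid_ne_prei e he c hc hce.symm
    · obtain ⟨wt, hwt, rfl⟩ := Finset.mem_image.mp hd
      exact hwkid_ne_prei wt hwt c hc hce.symm
  set cms' : Finset (Closeds (blowup (vanishingIdeal c₁))) := (kidsF.disjUnion wkidsF hdisj_kw).disjUnion survF hdisj_ks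
    with hcms'
  have hmem_cms' : ∀ d, d ∈ cms' ↔ (∃ e ∈ Pl, kid e = d) ∨ (∃ wt ∈ Wt₁, wkid wt = d) ∨ ∃ c ∈ cms.erase c₁, prei c = d :=
    fun d => by
    rw [hcms', Finset.mem_disjUnion, Finset.mem_disjUnion, hkidsF, hwkidsF, hsurvF, Finset.mem_image, Finset.mem_image,
      Finset.mem_image, or_assoc]
  -- the new data
  set cst' : Closeds (blowup (vanishingIdeal c₁)) → State K := fun d =>
    if h : ∃ e ∈ Pl, kid e = d then CentreBlowup.step p S₁ h.choose.1 h.choose.2.1 s₁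
    else if h' : ∃ wt ∈ Wt₁, wkid wt = d then CentreBlowup.step p S₁ h'.choose.1 h'.choose.2.1 s₁
    else if h'' : ∃ c ∈ cms.erase c₁, prei c = d then cst h''.choose else s₁ with hcst'
  set ctr' : Closeds (blowup (vanishingIdeal c₁)) → Finset (Fin 4) := fun d =>
    if h : ∃ e ∈ Pl, kid e = d then h.choose.2.2
    else if h' : ∃ wt ∈ Wt₁, wkid wt = d then h'.choose.2.2
    else if h'' : ∃ c ∈ cms.erase c₁, prei c = d then ctr h''.choose else S₁ with hctr'
  set wreg' : Closeds (blowup (vanishingIdeal c₁)) → Fin 4 × (Fin 4 → K) × Finset (Fin 4) →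
      Closeds (blowup (vanishingIdeal c₁)) := fun d =>
    if h : ∃ e ∈ Pl, kid e = d then rgn h.choose
    else if h' : ∃ wt ∈ Wt₁, wkid wt = d then fun _ => ⊥
    else if h'' : ∃ c ∈ cms.erase c₁, prei c = d then fun wt => prei (wreg h''.choose wt) else fun _ => ⊥ with hwreg'
  have hkid_rep : ∀ e ∈ Pl, cst' (kid e) = CentreBlowup.step p S₁ e.1 e.2.1 s₁ ∧ ctr' (kid e) = e.2.2 ∧ wreg' (kid e) = rgn e := by
    intro e he
    have h : ∃ e' ∈ Pl, kid e' = kid e := ⟨e, he, rfl⟩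
    have hch : h.choose = e := hkid_inj _ h.choose_spec.1 e he h.choose_spec.2
    exact ⟨by simp only [hcst', dif_pos h]; rw [hch], by simp only [hctr', dif_pos h]; rw [hch],
      by simp only [hwreg', dif_pos h]; rw [hch]⟩
  have hwkid_rep : ∀ wt ∈ Wt₁, cst' (wkid wt) = CentreBlowup.step p S₁ wt.1 wt.2.1 s₁ ∧ ctr' (wkid wt) = wt.2.2 ∧
      wreg' (wkid wt) = fun _ => ⊥ := by
    intro wt hwt
    have hn₀ : ¬ ∃ e ∈ Pl, kid e = wkid wt := fun ⟨e, he, hce⟩ => hkid_ne_wkid e he wt hwt hce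
    have h : ∃ wt' ∈ Wt₁, wkid wt' = wkid wt := ⟨wt, hwt, rfl⟩
    have hch : h.choose = wt := hwkid_inj _ h.choose_spec.1 wt hwt h.choose_spec.2
    exact ⟨by simp only [hcst', dif_neg hn₀, dif_pos h]; rw [hch], by simp only [hctr', dif_neg hn₀, dif_pos h]; rw [hch],
      by simp only [hwreg', dif_neg hn₀, dif_pos h]⟩
  have hsurv_rep : ∀ c ∈ cms.erase c₁, cst' (prei c) = cst c ∧ ctr' (prei c) = ctr c ∧
      wreg' (prei c) = fun wt => prei (wreg c wt) := by
    intro c hc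
    have hn₀ : ¬ ∃ e ∈ Pl, kid e = prei c := fun ⟨e, he, hec⟩ => hkid_ne_prei e he c hc hec
    have hn₁ : ¬ ∃ wt ∈ Wt₁, wkid wt = prei c := fun ⟨wt, hwt, hec⟩ => hwkid_ne_prei wt hwt c hc hec
    have h' : ∃ c' ∈ cms.erase c₁, prei c' = prei c := ⟨c, hc, rfl⟩
    have hch : h'.choose = c := hprei_inj h'.choose_spec.1 hc h'.choose_spec.2
    exact ⟨by simp only [hcst', dif_neg hn₀, dif_neg hn₁, dif_pos h']; rw [hch],
      by simp only [hctr', dif_neg hn₀, dif_neg hn₁, dif_pos h']; rw [hch],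
      by funext wt; simp only [hwreg', dif_neg hn₀, dif_neg hn₁, dif_pos h']; rw [hch]⟩
  -- where members and regions sit
  have hsit : ∀ d ∈ cms', ∀ w ∈ (d : Set (blowup (vanishingIdeal c₁))), blowup.π (vanishingIdeal c₁) w ∈ (c₁ : Set X') ∨
      (∃ wt ∈ Wt₁, blowup.π (vanishingIdeal c₁) w ∈ (wreg c₁ wt : Set X')) ∨
      ∃ c ∈ cms, c ≠ c₁ ∧ blowup.π (vanishingIdeal c₁) w ∈ (c : Set X') := by
    intro d hd w hw
    rcases (hmem_cms' d).mp hd with ⟨e, he, rfl⟩ | ⟨wt, hwt, rfl⟩ | ⟨c, hc, rfl⟩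
    · exact Or.inl (hkid_over e he w hw)
    · exact Or.inr (Or.inl ⟨wt, hwt, hwkid_over wt hwt w hw⟩)
    · exact Or.inr (Or.inr ⟨c, hmem₁ c hc, hne₁ c hc, hw⟩)
  have hrsit : ∀ d ∈ cms', ∀ wt ∈ wplan (cst' d) (ctr' d),
      (∃ e ∈ Pl, kid e = d ∧ wt ∈ wplan (CentreBlowup.step p S₁ e.1 e.2.1 s₁) e.2.2 ∧ wreg' d wt = rgn e wt) ∨
      (∃ c ∈ cms.erase c₁, prei c = d ∧ wt ∈ wplan (cst c) (ctr c) ∧ wreg' d wt = prei (wreg c wt)) := by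
    intro d hd wt hwt
    rcases (hmem_cms' d).mp hd with ⟨e, he, rfl⟩ | ⟨wt₀, hwt₀, rfl⟩ | ⟨c, hc, rfl⟩
    · obtain ⟨h1, h2, h3⟩ := hkid_rep e he
      rw [h1, h2] at hwt
      exact Or.inl ⟨e, he, rfl, hwt, by rw [h3]⟩
    · obtain ⟨h1, h2, -⟩ := hwkid_rep wt₀ hwt₀
      rw [h1, h2] at hwt
      have h0 := ((hcdata c₁ hc₁).2.2.2.2.2.2.1 (s₁, S₁) Relation.ReflTransGen.refl).2.2.2.2.2.2.2.1 wt₀ hwt₀ _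
        Relation.ReflTransGen.refl
      rw [h0] at hwt
      exact absurd hwt (Finset.notMem_empty wt)
    · obtain ⟨h1, h2, h3⟩ := hsurv_rep c hc
      rw [h1, h2] at hwt
      exact Or.inr ⟨c, hc, rfl, hwt, by rw [h3]⟩
  -- a singleton sum is a map
  have hsum : ∀ {ι : Type} [DecidableEq ι] (A : Finset ι) (f : ι → State K × Finset (Fin 4)),
      ∑ a ∈ A, ({f a} : Multiset (State K × Finset (Fin 4))) = A.val.map f := by
    intro ι _ A f
    induction A using Finset.induction_on with
    | empty => rfl
    | insert a A ha ih => rw [Finset.sum_insert ha, ih, Finset.insert_val_of_notMem ha, Multiset.map_cons, Multiset.singleton_add]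
  refine ⟨cms', cst', ctr', wreg', fun d hd => ?_, fun d hd d' hd' hdd => ?_, fun d hd d' hd' hdd wt hwt => ?_,
    fun d hd d' hd' hdd wt hwt wt' hwt' => ?_, ?_, fun d hd => ?_, hsit, fun d hd wt hwt w hw => ?_, fun w hw hwx hord => ?_,
    fun w hw hord hoff wt hwt hwT => ?_, fun w c hc hcc => ⟨fun hw => ?_, fun wt hwt hw => ?_⟩, ?_⟩
  · -- member data: children, waiting kids, survivors
    rcases (hmem_cms' d).mp hd with ⟨e, he, rfl⟩ | ⟨wt, hwt, rfl⟩ | ⟨c, hc, rfl⟩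
    · obtain ⟨h1, h2, h3⟩ := hkid_rep e he
      rw [h1, h2, h3]
      exact (hkid e he).1
    · obtain ⟨h1, h2, h3⟩ := hwkid_rep wt hwt
      rw [h1, h2, h3]
      exact (hwkid wt hwt).1
    · obtain ⟨h1, h2, h3⟩ := hsurv_rep c hc
      rw [h1, h2, h3]
      exact memberDataH_survival hπ M' hmult hsncC plan leaves wplan c (hdisjC c hc) (hcdata c (hmem₁ c hc)) fun wt hwt => by
        rw [hCsupp]; exact (hdisjW c₁ hc₁ c (hmem₁ c hc) (hne₁ c hc).symm wt hwt).symm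
  · -- members are pairwise disjoint
    rcases (hmem_cms' d).mp hd with ⟨e, he, rfl⟩ | ⟨wt, hwt, rfl⟩ | ⟨c, hc, rfl⟩
    · rcases (hmem_cms' d').mp hd' with ⟨e', he', rfl⟩ | ⟨wt', hwt', rfl⟩ | ⟨c', hc', rfl⟩
      · exact hkdisj e he e' he' fun h => hdd (by rw [h])
      · exact hkw e he wt' hwt'
      · exact Set.disjoint_left.mpr fun w hw hw' =>
          Set.disjoint_left.mp (hdisj₁ c' (hmem₁ c' hc') c₁ hc₁ (hne₁ c' hc')) hw' (hkid_over e he w hw)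
    · rcases (hmem_cms' d').mp hd' with ⟨e', he', rfl⟩ | ⟨wt', hwt', rfl⟩ | ⟨c', hc', rfl⟩
      · exact (hkw e' he' wt hwt).symm
      · exact hww wt hwt wt' hwt' fun h => hdd (by rw [h])
      · exact Set.disjoint_left.mpr fun w hw hw' =>
          Set.disjoint_left.mp (hdisjW c' (hmem₁ c' hc') c₁ hc₁ (hne₁ c' hc') wt hwt) hw' (hwkid_over wt hwt w hw)
    · rcases (hmem_cms' d').mp hd' with ⟨e', he', rfl⟩ | ⟨wt', hwt', rfl⟩ | ⟨c', hc', rfl⟩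
      · exact Set.disjoint_left.mpr fun w hw hw' =>
          Set.disjoint_left.mp (hdisj₁ c (hmem₁ c hc) c₁ hc₁ (hne₁ c hc)) hw (hkid_over e' he' w hw')
      · exact Set.disjoint_left.mpr fun w hw hw' =>
          Set.disjoint_left.mp (hdisjW c (hmem₁ c hc) c₁ hc₁ (hne₁ c hc) wt' hwt') hw (hwkid_over wt' hwt' w hw')
      · exact (hdisj₁ c (hmem₁ c hc) c' (hmem₁ c' hc') fun h => hdd (by rw [h])).preimage _
  · -- members miss the other members' regions
    rcases hrsit d' hd' wt hwt with ⟨e', he', rfl, hwt₀, hw4⟩ | ⟨c', hc', rfl, hwt₀, hw4⟩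
    · rw [hw4]
      rcases (hmem_cms' d).mp hd with ⟨e, he, rfl⟩ | ⟨wt₁, hwt₁, rfl⟩ | ⟨c, hc, rfl⟩
      · exact (hrk e' he' wt hwt₀ e he fun h => hdd (by rw [h])).symm
      · exact (hrw e' he' wt hwt₀ wt₁ hwt₁).symm
      · exact Set.disjoint_left.mpr fun w hw hw' =>
          Set.disjoint_left.mp (hdisj₁ c (hmem₁ c hc) c₁ hc₁ (hne₁ c hc)) hw (hrgn_over e' he' wt hwt₀ w hw')
    · rw [hw4]
      rcases (hmem_cms' d).mp hd with ⟨e, he, rfl⟩ | ⟨wt₁, hwt₁, rfl⟩ | ⟨c, hc, rfl⟩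
      · exact Set.disjoint_left.mpr fun w hw hw' =>
          Set.disjoint_left.mp (hdisjW c₁ hc₁ c' (hmem₁ c' hc') (hne₁ c' hc').symm wt hwt₀) (hkid_over e he w hw) hw'
      · exact Set.disjoint_left.mpr fun w hw hw' =>
          Set.disjoint_left.mp (hdisjWW c₁ hc₁ c' (hmem₁ c' hc') (hne₁ c' hc').symm wt₁ hwt₁ wt hwt₀)
            (hwkid_over wt₁ hwt₁ w hw) hw'
      · exact (hdisjW c (hmem₁ c hc) c' (hmem₁ c' hc') (fun h => hdd (by rw [h])) wt hwt₀).preimage _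
  · -- regions of different members are disjoint
    rcases hrsit d hd wt hwt with ⟨e, he, rfl, hwt₀, hw4⟩ | ⟨c, hc, rfl, hwt₀, hw4⟩
    · rcases hrsit d' hd' wt' hwt' with ⟨e', he', rfl, hwt₀', hw4'⟩ | ⟨c', hc', rfl, hwt₀', hw4'⟩
      · rw [hw4, hw4']
        exact hrr e he wt hwt₀ e' he' wt' hwt₀' fun h => hdd (by rw [(Prod.mk.inj h).1])
      · rw [hw4, hw4']
        exact Set.disjoint_left.mpr fun w hw hw' =>
          Set.disjoint_left.mp (hdisjW c₁ hc₁ c' (hmem₁ c' hc') (hne₁ c' hc').symm wt' hwt₀') (hrgn_over e he wt hwt₀ w hw) hw'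
    · rcases hrsit d' hd' wt' hwt' with ⟨e', he', rfl, hwt₀', hw4'⟩ | ⟨c', hc', rfl, hwt₀', hw4'⟩
      · rw [hw4, hw4']
        exact Set.disjoint_left.mpr fun w hw hw' =>
          Set.disjoint_left.mp (hdisjW c₁ hc₁ c (hmem₁ c hc) (hne₁ c hc).symm wt hwt₀) (hrgn_over e' he' wt' hwt₀' w hw') hw
      · rw [hw4, hw4']
        exact (hdisjWW c (hmem₁ c hc) c' (hmem₁ c' hc') (fun h => hdd (by rw [h])) wt hwt₀ wt' hwt₀').preimage _
  · -- the multiset identity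
    have hk : ∑ d ∈ kidsF, ({(cst' d, ctr' d)} : Multiset (State K × Finset (Fin 4))) =
        Pl.val.map fun e => (CentreBlowup.step p S₁ e.1 e.2.1 s₁, e.2.2) := by
      rw [hkidsF, Finset.sum_image fun e he e' he' h => hkid_inj e he e' he' h, ← hsum]
      refine Finset.sum_congr rfl fun e he => ?_
      obtain ⟨h1, h2, -⟩ := hkid_rep e he
      rw [h1, h2]
    have hw : ∑ d ∈ wkidsF, ({(cst' d, ctr' d)} : Multiset (State K × Finset (Fin 4))) =
        Wt₁.val.map fun wt => (CentreBlowup.step p S₁ wt.1 wt.2.1 s₁, wt.2.2) := by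
      rw [hwkidsF, Finset.sum_image fun wt hwt wt' hwt' h => hwkid_inj wt hwt wt' hwt' h, ← hsum]
      refine Finset.sum_congr rfl fun wt hwt => ?_
      obtain ⟨h1, h2, -⟩ := hwkid_rep wt hwt
      rw [h1, h2]
    have hs : ∑ d ∈ survF, ({(cst' d, ctr' d)} : Multiset (State K × Finset (Fin 4))) =
        ∑ c ∈ cms.erase c₁, ({(cst c, ctr c)} : Multiset (State K × Finset (Fin 4))) := by
      rw [hsurvF, Finset.sum_image hprei_inj]
      refine Finset.sum_congr rfl fun c hc => ?_
      obtain ⟨h1, h2, -⟩ := hsurv_rep c hc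
      rw [h1, h2]
    rw [hcms', Finset.sum_disjUnion, Finset.sum_disjUnion, hk, hw, hs, ← Finset.add_sum_erase cms _ hc₁]
    abel
  · -- the pairs of the new members
    rcases (hmem_cms' d).mp hd with ⟨e, he, rfl⟩ | ⟨wt, hwt, rfl⟩ | ⟨c, hc, rfl⟩
    · obtain ⟨h1, h2, -⟩ := hkid_rep e he
      exact Or.inl ⟨e, Or.inl he, by rw [h1, h2]⟩
    · obtain ⟨h1, h2, -⟩ := hwkid_rep wt hwt
      exact Or.inl ⟨wt, Or.inr hwt, by rw [h1, h2]⟩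
    · obtain ⟨h1, h2, -⟩ := hsurv_rep c hc
      exact Or.inr ⟨c, hmem₁ c hc, hne₁ c hc, by rw [h1, h2]⟩
  · -- where the regions sit
    rcases hrsit d hd wt hwt with ⟨e, he, rfl, hwt₀, hw4⟩ | ⟨c, hc, rfl, hwt₀, hw4⟩
    · rw [hw4] at hw
      exact Or.inl (hrgn_over e he wt hwt₀ w hw)
    · rw [hw4] at hw
      exact Or.inr ⟨c, hmem₁ c hc, hne₁ c hc, wt, hwt₀, hw⟩
  · -- four-way cover over the host, modulo leaves
    rcases hkcover w hw hwx hord with ⟨e, he, hwe⟩ | ⟨wt, hwt, hwe⟩ | ⟨e, he, wt, hwt, hwe⟩ | h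
    · exact Or.inl ⟨kid e, (hmem_cms' _).mpr (Or.inl ⟨e, he, rfl⟩), hwe⟩
    · exact Or.inl ⟨wkid wt, (hmem_cms' _).mpr (Or.inr (Or.inl ⟨wt, hwt, rfl⟩)), hwe⟩
    · obtain ⟨h1, h2, h3⟩ := hkid_rep e he
      exact Or.inr (Or.inl ⟨kid e, (hmem_cms' _).mpr (Or.inl ⟨e, he, rfl⟩), wt, by rw [h1, h2]; exact hwt,
        by rw [h3]; exact hwe⟩)
    · exact Or.inr (Or.inr h)
  · -- cover off the host over a waiting region of the host
    exact ⟨wkid wt, (hmem_cms' _).mpr (Or.inr (Or.inl ⟨wt, hwt, rfl⟩)), hwcover w hw hord hoff wt hwt hwT⟩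
  · -- survivors cover
    exact ⟨prei c, (hmem_cms' _).mpr (Or.inr (Or.inr ⟨c, Finset.mem_erase.mpr ⟨hcc, hc⟩, rfl⟩)), hw⟩
  · -- survivor regions cover
    have hc' : c ∈ cms.erase c₁ := Finset.mem_erase.mpr ⟨hcc, hc⟩
    obtain ⟨h1, h2, h3⟩ := hsurv_rep c hc'
    exact ⟨prei c, (hmem_cms' _).mpr (Or.inr (Or.inr ⟨c, hc', rfl⟩)), wt, by rw [h1, h2]; exact hwt, by rw [h3]; exact hw⟩
  · -- finiteness of the leaf points
    refine hkfin.subset fun w ⟨hw, hwx, hord, hout, houtr⟩ => ⟨hw, hwx, hord, fun e he => hout _ ((hmem_cms' _).mpr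
      (Or.inl ⟨e, he, rfl⟩)), fun wt hwt => hout _ ((hmem_cms' _).mpr (Or.inr (Or.inl ⟨wt, hwt, rfl⟩))), fun e he wt hwt => ?_⟩
    obtain ⟨h1, h2, h3⟩ := hkid_rep e he
    have h := houtr (kid e) ((hmem_cms' _).mpr (Or.inl ⟨e, he, rfl⟩)) wt (by rw [h1, h2]; exact hwt)
    rwa [h3] at h

end NodeStepH

end Equimultiple

end Summit.ResolutionOfSingularities.ResolutionOfSingularities.Theorems.PIDim4

end
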